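import Literature.Probability.Percolation.OneArmBoundaryArmsMixed
import Literature.Probability.Percolation.OneArmPivotalSumSub
import Literature.Probability.Percolation.NearCriticalScalingOneArmProofs
import HarnessLib

/-!
# The one-arm pivotal sum on both sides of `1/2`, and Nolin's Thm. 27 (`j = 1`) from five named facts (proofs only)

Topic `Literature/Probability/Percolation`; family `crit-perc`, statement **crit-perc.S16**
(`Literature.Probability.Percolation.triTheta_exponent`). Proofs only (no new definition, no new
named fact). Conclusion of the sub-critical half of the named fact `Nolin2008_thm27_oneArm`
(`NearCriticalScaling.lean`; P. Nolin, *Electron. J. Probab.* 13 (2008), §6.1, Thm. 27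
[arXiv 0711.4948: Thm. 26], `j = 1`, "uniformly in `P̂` between `P_p` and `P_{1-p}`"): after
`NearCriticalScalingOneArmProofs.lean` (the integration step on both sides and the reduction
`Nolin2008_thm27_oneArm_of_nearCritical_of_pivotal_bound_div`), `OneArmQuasiMultNearCritical.lean`
(RSW, quasi-multiplicativity and extendability of the open arm below `L_ε` on the sub-critical
side), `NearCriticalFourArmFactsSymm.lean` (the four-arm facts two-sidedly by colour exchange),
`OneArmPivotalSumSub.lean` (the bulk of the pivotal sum two-sidedly) and
`OneArmBoundaryArmsMixed.lean` (the mixed half-plane pair at boundary pivotal sites), this file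
PROVES:

* `oneArmPivotalSum_layer_le_twoSided` — the boundary layer `9N/10 < |v|_𝕋 ≤ N` of Werner's
  differential inequality (C) (W. Werner, PCMI 2009, Lecture 6, proof of Lemma 6.2, boundary
  contributions, and §5) on BOTH sides of `1/2`, from `Werner2009_fourArm_quasiMult`,
  `Werner2009_fourArm_lowerBound` and Werner's near-critical half-plane two-arm bound
  `Werner2009_halfPlane_twoArm` (mixed pair; in place of the critical `Nolin2008_halfPlane_twoArm`
  and the monotonicity of the two closed arms used by the tree for `t ≥ 1/2`), verbatim the tree's
  `oneArmPivotalSum_layer_le` with `boundary_pivotal_three_le_mixed` / `_two_le_mixed`;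
* `oneArmPivotalSum_le_twoSided` — (C) two-sidedly:
  `Σ_{v ∈ Λ_N} P_t(v pivotal for 0 ↔ ∂Λ_N) ≤ C · N² π̂_t(r₀, N) · P_t(0 ↔ ∂Λ_N)` for `|t - 1/2| < δ`,
  `t ≠ 1/2`, `n₁ ≤ N`, `4N ≤ L_ε(t)`;
* `real_isPivotal_triLRCrossing_symm'`, `sum_isPivotal_easy_eq_paraPivotalSum_symm`,
  `hasDerivAt_triLRCrossingProb_easy`, `real_le_exp_mul_of_easy_pivotal_bound`,
  `oneArm_sub_of_para_pivotal_bound_div` — the sub-critical integration against WERNER's potential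
  at the dual parameter: by colour exchange, the Hex lemma and transposition, the pivotal count of
  the easy-way crossing `LR(N, 2N)` at `t` is `paraPivotalSum (1 - t) N` (Werner's `d/dp h_p(N)` at
  `p = 1 - t ≥ 1/2`), so that Lemma 6.2, stated for `p ≥ 1/2`, serves the side `t < 1/2`;
* `oneArm_para_pivotal_bound_of_facts` — the merged sub-critical pivotal estimate
  `Σ_v P_t(v pivotal for 0 ↔ ∂Λ_N) ≤ K · paraPivotalSum (1 - t) N · P_t(0 ↔ ∂Λ_N)`, `t ∈ (1/2 - δ, 1/2)`,
  `n₁ ≤ N`, `4N ≤ L_ε(t)`, from (C) two-sidedly, `π̂_t = π̂_{1-t}` and (A) `Werner2009_lemma62P`;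
* `Nolin2008_thm27_oneArm_of_facts` — **Nolin's Thm. 27 for one arm from the five named facts of
  Kesten's near-critical theory recorded in the tree**: `Werner2009_fourArm_quasiMult` (Werner
  Cor. 6.2), `Werner2009_fourArm_lowerBound` (§3), `Nolin2008_halfPlane_twoArm` (Nolin Thm. 24 (i)),
  `Werner2009_halfPlane_twoArm` (§3 ¶1), `Werner2009_pivotal_lowerBound` (proof of Lemma 6.2) —
  exactly the facts behind `Werner2009_oneArm_nearCritical_of_facts` (the super-critical half); and
  `Nolin2008_thm27_oneArm_of_nearCritical_of_facts` (from `Werner2009_oneArm_nearCritical`,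
  `Werner2009_lemma62P` and the three facts of the sub-critical pivotal sum).

## References

* P. Nolin, Near-critical percolation in two dimensions, *Electron. J. Probab.* 13 (2008), §6.1–6.2,
  Thm. 27 and its proof, Case 1; §4.6; §7.3 Prop. 34 [arXiv 0711.4948: Thm. 26, Prop. 32] [Nolin2008].
* B. Bollobás, O. Riordan, *Percolation* (2006), Ch. 5, Lemma 7 (Hex lemma) [BollobasRiordan2006].
* W. Werner, *Lectures on two-dimensional critical percolation*, IAS/Park City Math. Ser. 16 (2009),
  Lecture 6, §3, Cor. 6.2, Lemma 6.2 (proof), Lemma 6.3, §5 [WernerPCMI2009].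
* H. Kesten, Scaling relations for 2D-percolation, *Comm. Math. Phys.* 109 (1987) [KestenScalingCMP1987].

Tree: `boundary_pivotal_three_le_mixed`, `boundary_pivotal_two_le_mixed`,
`Werner2009_halfPlane_twoArm.two_sided` (`OneArmBoundaryArmsMixed.lean`), `oneArmPivotalSum_bulk_le_twoSided`
(`OneArmPivotalSumSub.lean`), `layer_ratio_le`, `layer_ratio_le'`, `layer_sum_deep_le`,
`layer_sum_shallow_le` (`OneArmPivotalLayer.lean`), `fourArmProbAt_le_ratio_mul`,
`sum_triBall_eq_sum_triSphere` (`OneArmPivotalSum.lean`), `Werner2009_fourArm_quasiMult.two_sided`,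
`Werner2009_fourArm_lowerBound.two_sided`, `fourArmProbAt_symm`, `symm_mem_of_lt_half`
(`NearCriticalFourArmFactsSymm.lean`), `triOneArm_extend_nearCritical` (`OneArmQuasiMultNearCritical.lean`),
`paraPivotalSum`, `Werner2009_lemma62P` (`WernerCorrelationLength.lean`, `WernerPivotalEstimates.lean`),
`charLength_le_charLengthW`, `charLengthW_symm` (`WernerCorrelationLength(Proofs).lean`),
`compl_triLRCrossing_eq`, `preimage_compl_setOf_isPivotal`, `isPivotal_compl_iff`,
`preimage_relabel_setOf_isPivotal` (`KestenRelationRussoProofs.lean`), `relabel_transpose_preimage_triLRCrossing`,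
`sitePercolation_real_preimage_compl` (`TriHexLemma.lean`), `site_russo_formula_sum` (`SiteRusso.lean`),
`Werner2009_oneArm_nearCritical_of_facts`, `Werner2009_lemma62P_of_facts` (`ParaPivotalSumBounds.lean`),
`real_le_exp_mul_of_pivotal_bound`, `real_triOneArm_extend_iter`, `le_four_pow_self`,
`pow_succ_le_real_triOneArm`, `Nolin2008_thm27_oneArm_of_nearCritical_of_sub` (`NearCriticalScalingOneArmProofs.lean`).
-/

noncomputable section

open MeasureTheory Set Finset Real
open scoped unitInterval

namespace Literature.Probability.Percolation

open LatticeModels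

/-! ### The boundary layer on both sides of `1/2` -/

set_option maxHeartbeats 400000 in
/-- **The one-arm pivotal sum over the boundary layer, both sides of `1/2`** (Werner 2009,
Lecture 6, proof of Lemma 6.2, boundary contributions, with §5 for the one-arm event; Nolin 2008,
§6.2 with §4.6): for every small enough `ε` and every large inner radius `r₀` there are `n₁`,
`δ > 0`, `C` with `Σ_{9N/10 < |v|_𝕋 ≤ N} P_t(v pivotal for {0 ↔ ∂Λ_N}) ≤ C · N² π̂_t(r₀, N) · P_t(0 ↔ ∂Λ_N)`
for `|t - 1/2| < δ`, `t ≠ 1/2`, `n₁ ≤ N`, `4N ≤ L_ε(t)`. Shells at depth `d' ≥ d₀` use the mixed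
pair (`boundary_pivotal_three_le_mixed`: `cst N^{2-β} d'^{β-1} π̂ P` each, the half-plane factor
`P_t(B_{T,F}(2d'+1, D-d')) ≤ CH (2d'+1)/(D-d')` by `Werner2009_halfPlane_twoArm` two-sidedly), the
`d₀` shells closest to the boundary `boundary_pivotal_two_le_mixed`. [cite: WernerPCMI2009, Lecture 6, proof of Lemma 6.2 (boundary contributions) and §5] [cite: Nolin2008, §6.2 (proof of Thm. 27, Case 1) and §4.6 (arXiv 0711.4948: Thm. 26)] -/
theorem oneArmPivotalSum_layer_le_twoSided (hQM : Werner2009_fourArm_quasiMult)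
    (hLB : Werner2009_fourArm_lowerBound) (hHPW : Werner2009_halfPlane_twoArm) :
    ∃ ε₁ > (0 : ℝ), ∀ ⦃ε : ℝ⦄, 0 < ε → ε < ε₁ →
      ∃ r₁ : ℕ, ∀ r₀ ≥ r₁, ∃ n₁ : ℕ, ∃ δ > (0 : ℝ), ∃ C : ℝ,
        ∀ t : unitInterval, |(t : ℝ) - 1 / 2| < δ → (t : ℝ) ≠ 1 / 2 →
          ∀ N : ℕ, n₁ ≤ N → 4 * N ≤ charLength ε t →
            ∑ k ∈ Finset.Ico (9 * N / 10 + 1) (N + 1), ∑ v ∈ triSphere k,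
                (triSitePercolation t).real {ω | IsPivotal (triOneArm N) v ω} ≤
              C * ((N : ℝ) ^ 2 * fourArmProbAt t r₀ N) * (triSitePercolation t).real (triOneArm N) := by
  classical
  obtain ⟨εQ, hεQ, HQ⟩ := hQM.two_sided
  obtain ⟨εL, hεL, HL⟩ := hLB.two_sided
  obtain ⟨εH, hεH, HH⟩ := hHPW.two_sided
  refine ⟨min (min εQ εL) (min εH (1 / 2)), lt_min (lt_min hεQ hεL) (lt_min hεH (by norm_num)),
    fun ε hε hε₁ => ?_⟩
  have hεQ' : ε < εQ := hε₁.trans_le ((min_le_left _ _).trans (min_le_left _ _))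
  have hεL' : ε < εL := hε₁.trans_le ((min_le_left _ _).trans (min_le_right _ _))
  have hεH' : ε < εH := hε₁.trans_le ((min_le_right _ _).trans (min_le_left _ _))
  have hε2 : ε < 1 / 2 := hε₁.trans_le ((min_le_right _ _).trans (min_le_right _ _))
  obtain ⟨rQ, δQ, hδQ, cQ, hcQ, hQ⟩ := HQ hε hεQ'
  obtain ⟨rL, δL, hδL, β₀, hβ₀, cL, hcL, hL⟩ := HL hε hεL'
  obtain ⟨n₀, δH, hδH, CH, hHP⟩ := HH hε hεH'
  obtain ⟨c', hc', hext⟩ := triOneArm_extend_nearCritical hε hε2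
  set β : ℝ := min β₀ 1 with hβdef
  have hβ : 0 < β := lt_min hβ₀ one_pos
  have hβ1 : β ≤ 1 := min_le_right _ _
  have hβ2 : β ≤ 2 := hβ1.trans one_le_two
  have hββ₀ : β ≤ β₀ := min_le_left _ _
  have hCH0 : 0 ≤ CH := by
    have hhalf : |((half : unitInterval) : ℝ) - 1 / 2| < δH := by
      rw [coe_half, sub_self, abs_zero]; exact hδH
    have h := hHP half hhalf (max n₀ 1) (max n₀ 1) (le_max_left _ _) le_rfl
      fun hne => absurd coe_half hne
    have hne : ((max n₀ 1 : ℕ) : ℝ) ≠ 0 := Nat.cast_ne_zero.2 (by omega)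
    rw [div_self hne, mul_one] at h
    exact measureReal_nonneg.trans h
  refine ⟨max (max rQ rL) 1, fun r₀ hr₀ => ?_⟩
  have hrQ : rQ ≤ r₀ := ((le_max_left _ _).trans (le_max_left _ _)).trans hr₀
  have hrL : rL ≤ r₀ := ((le_max_right _ _).trans (le_max_left _ _)).trans hr₀
  have hr1 : 1 ≤ r₀ := (le_max_right _ _).trans hr₀
  obtain ⟨d₀, hd₀⟩ : ∃ d₀ : ℕ, d₀ = 4 * r₀ + 1 + rL + n₀ := ⟨_, rfl⟩
  -- constants
  set K₁ : ℝ := 44 * CH / (c' * (cQ * cL)) with hK₁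
  set C₁ : ℝ := 18 * K₁ * (1 + 1 / β) with hC₁
  set C₂ : ℝ := (d₀ : ℝ) * (18 * (7 * CH * (d₀ : ℝ) / c')) / cL with hC₂
  have hK₁0 : 0 ≤ K₁ := by rw [hK₁]; positivity
  refine ⟨max 8000 (20 * d₀ + 100), min (min δQ δL) δH, lt_min (lt_min hδQ hδL) hδH, C₁ + C₂,
    fun t htδ htne N hN hNL => ?_⟩
  have hN8 : 8000 ≤ N := (le_max_left _ _).trans hN
  have hNd : 20 * d₀ + 100 ≤ N := (le_max_right _ _).trans hN
  have hN0 : (0 : ℝ) < N := by exact_mod_cast (show 0 < N by omega)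
  have htQ : |(t : ℝ) - 1 / 2| < δQ := htδ.trans_le ((min_le_left _ _).trans (min_le_left _ _))
  have htL : |(t : ℝ) - 1 / 2| < δL := htδ.trans_le ((min_le_left _ _).trans (min_le_right _ _))
  have htH : |(t : ℝ) - 1 / 2| < δH := htδ.trans_le (min_le_right _ _)
  -- `N ≤ L_ε(t) ≤ L(t, ε)`
  have hNLε : N ≤ charLength ε t := le_trans (by omega) hNL
  have hNW : N ≤ charLengthW ε t := hNLε.trans (charLength_le_charLengthW hε htne)
  -- the facts at `t`, radii `≤ N`
  have hQt : ∀ R S : ℕ, 16 * r₀ < 4 * R → 4 * R < S → S ≤ N →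
      cQ * (fourArmProbAt t r₀ R * fourArmProbAt t (4 * R) S) ≤ fourArmProbAt t r₀ S :=
    fun R S h1 h2 h3 => hQ t htQ r₀ R S hrQ h1 h2 fun _ => h3.trans hNW
  have hLt : ∀ m n : ℕ, rL ≤ m → m ≤ n → n ≤ N →
      cL * ((m : ℝ) / n) ^ (2 - β) ≤ fourArmProbAt t m n := by
    intro m n h1 h2 h3
    have h := hL t htL m n h1 h2 fun _ => h3.trans hNW
    refine le_trans (mul_le_mul_of_nonneg_left ?_ hcL.le) h
    rcases Nat.eq_zero_or_pos m with hm | hm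
    · subst hm
      simp only [CharP.cast_eq_zero, zero_div]
      rw [Real.zero_rpow (ne_of_gt (by linarith))]
      exact Real.rpow_nonneg le_rfl _
    · have hn : 0 < n := by omega
      apply Real.rpow_le_rpow_of_exponent_ge
      · exact div_pos (by exact_mod_cast hm) (by exact_mod_cast hn)
      · rw [div_le_one (by exact_mod_cast hn)]; exact_mod_cast h2
      · linarith
  have hHPt : ∀ m n : ℕ, n₀ ≤ m → m ≤ n → n ≤ N →
      (triSitePercolation t).real (domArmEvent ![true, false] m n upperHalfPlane) ≤ CH * ((m : ℝ) / n) :=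
    fun m n h1 h2 h3 => hHP t htH m n h1 h2 fun _ => h3.trans hNW
  obtain ⟨AN, hANdef⟩ : ∃ x : ℝ, x = (triSitePercolation t).real (triOneArm N) := ⟨_, rfl⟩
  obtain ⟨πN, hπNdef⟩ : ∃ x : ℝ, x = fourArmProbAt t r₀ N := ⟨_, rfl⟩
  rw [← hANdef, ← hπNdef]
  obtain ⟨Q, hQdef⟩ : ∃ x : ℝ, x = πN * AN := ⟨_, rfl⟩
  have hπN : 0 ≤ πN := by rw [hπNdef]; exact fourArmProbAt_nonneg t r₀ N
  have hAN : 0 ≤ AN := by rw [hANdef]; exact measureReal_nonneg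
  have hQ0 : 0 ≤ Q := by rw [hQdef]; exact mul_nonneg hπN hAN
  -- `N² π̂(r₀, N) ≥ c_L`
  have hNπ : cL ≤ (N : ℝ) ^ 2 * πN := by
    have h := hLt r₀ N hrL (by omega) le_rfl
    rw [← hπNdef] at h
    have hr0 : (0 : ℝ) < r₀ := by exact_mod_cast (show 0 < r₀ by omega)
    have hbase : (r₀ : ℝ) / N ≤ 1 := by rw [div_le_one hN0]; exact_mod_cast (show r₀ ≤ N by omega)
    have hb0 : (0 : ℝ) < (r₀ : ℝ) / N := div_pos hr0 hN0
    have h1 : ((r₀ : ℝ) / N) ^ (2 : ℝ) ≤ ((r₀ : ℝ) / N) ^ (2 - β) :=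
      Real.rpow_le_rpow_of_exponent_ge hb0 hbase (by linarith)
    have h2 : (1 / (N : ℝ)) ^ 2 ≤ ((r₀ : ℝ) / N) ^ (2 : ℝ) := by
      rw [Real.rpow_two]
      apply pow_le_pow_left₀ (by positivity)
      exact div_le_div_of_nonneg_right (by exact_mod_cast hr1) hN0.le
    have h3 : (N : ℝ) ^ 2 * (1 / (N : ℝ)) ^ 2 = 1 := by field_simp
    have h4 : cL = (N : ℝ) ^ 2 * (cL * (1 / (N : ℝ)) ^ 2) := by
      calc cL = cL * ((N : ℝ) ^ 2 * (1 / (N : ℝ)) ^ 2) := by rw [h3, mul_one]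
        _ = (N : ℝ) ^ 2 * (cL * (1 / (N : ℝ)) ^ 2) := by ring
    calc cL = (N : ℝ) ^ 2 * (cL * (1 / (N : ℝ)) ^ 2) := h4
      _ ≤ (N : ℝ) ^ 2 * (cL * ((r₀ : ℝ) / N) ^ (2 - β)) := by
          apply mul_le_mul_of_nonneg_left _ (by positivity)
          exact mul_le_mul_of_nonneg_left (h2.trans h1) hcL.le
      _ ≤ (N : ℝ) ^ 2 * πN := mul_le_mul_of_nonneg_left h (by positivity)
  obtain ⟨D, hD⟩ : ∃ D : ℕ, D = 2 * N / 5 := ⟨_, rfl⟩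
  obtain ⟨M, hM⟩ : ∃ M : ℕ, M = 9 * N / 10 := ⟨_, rfl⟩
  -- one extension (scale `a = N/8 + 1 ≤ N`, `4a ≤ L_ε(t)` when `t < 1/2`)
  have hextN : ∀ m₀ : ℕ, N ≤ 2 * m₀ + 2 → (triSitePercolation t).real (triOneArm m₀) ≤ 1 / c' * AN := by
    intro m₀ hm₀
    have h := hext t (N / 8 + 1) (by omega) (fun _ => by omega) m₀ N (by omega) (by omega)
    rw [← hANdef] at h
    rw [one_div, ← div_eq_inv_mul, le_div_iff₀' hc']
    exact h
  -- deep shells: `d' = N - k ≥ d₀`, three factors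
  have hsite3 : ∀ k ∈ Finset.Ico (M + 1) (N - d₀ + 1), ∀ v ∈ triSphere k,
      (triSitePercolation t).real {ω | IsPivotal (triOneArm N) v ω} ≤
        K₁ * (((N : ℝ) / ((N - k : ℕ) : ℝ)) ^ (2 - β) * (((N - k : ℕ) : ℝ) / N)) * Q := by
    intro k hk v hv
    rw [Finset.mem_Ico] at hk
    rw [mem_triSphere_iff] at hv
    obtain ⟨d', hd'⟩ : ∃ d' : ℕ, d' = N - k := ⟨_, rfl⟩
    rw [← hd']
    have hkN' : k + d' = N := by omega
    have hdd : d₀ ≤ d' := by omega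
    have hr₀d : r₀ ≤ d' := by omega
    have h2d : 2 * d' ≤ k := by omega
    have hD1 : 1 ≤ D := by omega
    have h2D : 2 * D ≤ k := by omega
    have hm₀ : (k - D - 1) + D + 1 ≤ k := by omega
    have hrec : (d' + 1) + 2 * d' + 1 ≤ D := by omega
    have h3 := boundary_pivotal_three_le_mixed t (N := N) (D := D) (m₀ := k - D - 1) hv hkN' hr1 hr₀d h2d
      hD1 h2D hm₀ (le_refl (d' + 1)) hrec
    have hA := hextN (k - D - 1) (by omega)
    have hπ := fourArmProbAt_le_ratio_mul hcQ hcL hβ hβ2 hQt hLt (by omega) (by omega)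
      (d := d') (by omega) (by omega) (by omega)
    rw [← hπNdef] at hπ
    have h2d1 : d' + 1 + d' = 2 * d' + 1 := by ring
    rw [h2d1] at h3
    have hhp : (triSitePercolation t).real
        (domArmEvent ![true, false] (2 * d' + 1) (D - d') upperHalfPlane) ≤ 11 * CH * ((d' : ℝ) / N) := by
      refine (hHPt (2 * d' + 1) (D - d') (by omega) (by omega) (by omega)).trans ?_
      have := layer_ratio_le (N := N) (D := D) (d' := d') (by omega) hD (by omega) (by omega)
      calc CH * (((2 * d' + 1 : ℕ) : ℝ) / ((D - d' : ℕ) : ℝ)) ≤ CH * (11 * ((d' : ℝ) / N)) :=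
            mul_le_mul_of_nonneg_left this hCH0
        _ = 11 * CH * ((d' : ℝ) / N) := by ring
    have hd'0 : (0 : ℝ) ≤ (d' : ℝ) / N := by positivity
    have hX0 : (0 : ℝ) ≤ ((N : ℝ) / d') ^ (2 - β) := by positivity
    generalize ((N : ℝ) / d') ^ (2 - β) = X at hπ hX0 ⊢
    calc (triSitePercolation t).real {ω | IsPivotal (triOneArm N) v ω}
        ≤ (triSitePercolation t).real (triOneArm (k - D - 1)) * (fourArmProbAt t r₀ d' *
            (triSitePercolation t).real
              (domArmEvent ![true, false] (2 * d' + 1) (D - d') upperHalfPlane)) := h3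
      _ ≤ (1 / c' * AN) * ((4 / (cQ * cL) * X * πN) * (11 * CH * ((d' : ℝ) / N))) := by
          refine mul_le_mul hA (mul_le_mul hπ hhp measureReal_nonneg (by positivity))
            (mul_nonneg (fourArmProbAt_nonneg t r₀ d') measureReal_nonneg) (by positivity)
      _ = K₁ * (X * ((d' : ℝ) / N)) * Q := by
          rw [hK₁, hQdef]; field_simp; ring
  -- shallow shells: `d' < d₀`, two factors
  have hsite2 : ∀ k ∈ Finset.Ico (N - d₀ + 1) (N + 1), ∀ v ∈ triSphere k,
      (triSitePercolation t).real {ω | IsPivotal (triOneArm N) v ω} ≤ 7 * CH * (d₀ : ℝ) / (c' * N) * AN := by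
    intro k hk v hv
    rw [Finset.mem_Ico] at hk
    rw [mem_triSphere_iff] at hv
    obtain ⟨d', hd'⟩ : ∃ d' : ℕ, d' = N - k := ⟨_, rfl⟩
    have hkN' : k + d' = N := by omega
    have hdd : d' < d₀ := by omega
    have hD1 : 1 ≤ D := by omega
    have h2D : 2 * D ≤ k := by omega
    have hm₀ : (k - D - 1) + D + 1 ≤ k := by omega
    have hd01 : 1 ≤ d₀ := by omega
    have hrec : d₀ + 2 * d' + 1 ≤ D := by omega
    have h2 := boundary_pivotal_two_le_mixed t (N := N) (D := D) (m₀ := k - D - 1) hv hkN' hD1 h2D hm₀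
      hd01 hrec
    have hA := hextN (k - D - 1) (by omega)
    have hhp : (triSitePercolation t).real
        (domArmEvent ![true, false] (d₀ + d') (D - d') upperHalfPlane) ≤ 7 * CH * ((d₀ : ℝ) / N) := by
      refine (hHPt (d₀ + d') (D - d') (by omega) (by omega) (by omega)).trans ?_
      have := layer_ratio_le' (N := N) (D := D) (d' := d') (d₀ := d₀) hNd hD hdd
      calc CH * ((((d₀ + d' : ℕ) : ℝ)) / ((D - d' : ℕ) : ℝ)) ≤ CH * (7 * ((d₀ : ℝ) / N)) :=
            mul_le_mul_of_nonneg_left this hCH0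
        _ = 7 * CH * ((d₀ : ℝ) / N) := by ring
    calc (triSitePercolation t).real {ω | IsPivotal (triOneArm N) v ω}
        ≤ (triSitePercolation t).real (triOneArm (k - D - 1)) *
            (triSitePercolation t).real (domArmEvent ![true, false] (d₀ + d') (D - d') upperHalfPlane) := h2
      _ ≤ (1 / c' * AN) * (7 * CH * ((d₀ : ℝ) / N)) :=
          mul_le_mul hA hhp measureReal_nonneg (by positivity)
      _ = 7 * CH * (d₀ : ℝ) / (c' * N) * AN := by field_simp
  -- split the layer into the two regimes and sum
  set P : Site 2 → ℝ := fun v => (triSitePercolation t).real {ω | IsPivotal (triOneArm N) v ω} with hP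
  have hsplit : ∑ k ∈ Finset.Ico (M + 1) (N + 1), ∑ v ∈ triSphere k, P v =
      ∑ k ∈ Finset.Ico (M + 1) (N - d₀ + 1), ∑ v ∈ triSphere k, P v +
        ∑ k ∈ Finset.Ico (N - d₀ + 1) (N + 1), ∑ v ∈ triSphere k, P v :=
    (Finset.sum_Ico_consecutive _ (by omega) (by omega)).symm
  have hsum3 := layer_sum_deep_le hK₁0 hQ0 hβ hβ1 (by omega) (by omega) P hsite3
  have hB0 : 0 ≤ 7 * CH * (d₀ : ℝ) / (c' * N) * AN := by positivity
  have hsum2 := layer_sum_shallow_le (by omega) hB0 P hsite2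
  have hcard : ((N + 1 - (N - d₀ + 1) : ℕ) : ℝ) = d₀ := by
    have : N + 1 - (N - d₀ + 1) = d₀ := by omega
    rw [this]
  rw [hcard] at hsum2
  have h1 : (1 : ℝ) ≤ (N : ℝ) ^ 2 * πN / cL := by
    rw [le_div_iff₀ hcL, one_mul]; exact hNπ
  have hshallow : (d₀ : ℝ) * (18 * N * (7 * CH * (d₀ : ℝ) / (c' * N) * AN)) ≤ C₂ * ((N : ℝ) ^ 2 * Q) := by
    have e1 : (d₀ : ℝ) * (18 * N * (7 * CH * (d₀ : ℝ) / (c' * N) * AN)) =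
        (d₀ : ℝ) * (18 * (7 * CH * (d₀ : ℝ) / c')) * AN := by
      field_simp
    have e2 : C₂ * ((N : ℝ) ^ 2 * Q) = (d₀ : ℝ) * (18 * (7 * CH * (d₀ : ℝ) / c')) *
        ((N : ℝ) ^ 2 * πN / cL * AN) := by
      rw [hC₂, hQdef]; ring
    rw [e1, e2]
    have hc0 : 0 ≤ (d₀ : ℝ) * (18 * (7 * CH * (d₀ : ℝ) / c')) := by positivity
    apply mul_le_mul_of_nonneg_left _ hc0
    calc AN = 1 * AN := (one_mul _).symm
      _ ≤ (N : ℝ) ^ 2 * πN / cL * AN := mul_le_mul_of_nonneg_right h1 hAN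
  rw [← hM]
  show ∑ k ∈ Finset.Ico (M + 1) (N + 1), ∑ v ∈ triSphere k, P v ≤ (C₁ + C₂) * ((N : ℝ) ^ 2 * πN) * AN
  rw [hsplit]
  calc _ ≤ 18 * K₁ * (1 + 1 / β) * ((N : ℝ) ^ 2 * Q) + C₂ * ((N : ℝ) ^ 2 * Q) :=
        add_le_add hsum3 (hsum2.trans hshallow)
    _ = (C₁ + C₂) * ((N : ℝ) ^ 2 * πN) * AN := by rw [hC₁, hQdef]; ring

/-! ### (C) on both sides of `1/2` -/

/-- **The one-arm pivotal sum on both sides of `1/2`** (Werner 2009, Lecture 6, §5: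
`Σ_x P_p(x pivotal for 0 ↔ ∂Λ_n) ≤ c n² π̂_p(n) P_p(0 ↔ ∂Λ_n)`; Nolin 2008, §6.2, proof of Thm. 27,
Case 1, eqs. (6.6)–(6.9), "uniformly in `P̂` between `P_p` and `P_{1-p}`"): from the four-arm
quasi-multiplicativity, the a priori four-arm lower bound and the near-critical half-plane two-arm
bound, for every small `ε` and large `r₀` there are `n₁`, `δ > 0`, `C` with
`Σ_{v ∈ Λ_N} P_t(v pivotal for {0 ↔ ∂Λ_N}) ≤ C · N² π̂_t(r₀, N) · P_t(0 ↔ ∂Λ_N)` for `|t - 1/2| < δ`,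
`t ≠ 1/2`, `n₁ ≤ N`, `4N ≤ L_ε(t)` (bulk `oneArmPivotalSum_bulk_le_twoSided` plus layer
`oneArmPivotalSum_layer_le_twoSided`). [cite: WernerPCMI2009, Lecture 6, §5 ("Using differential inequalities for the one-arm event")] [cite: Nolin2008, §6.2, proof of Thm. 27, Case 1 (arXiv 0711.4948: Thm. 26)] -/
theorem oneArmPivotalSum_le_twoSided (hQM : Werner2009_fourArm_quasiMult)
    (hLB : Werner2009_fourArm_lowerBound) (hHPW : Werner2009_halfPlane_twoArm) :
    ∃ ε₁ > (0 : ℝ), ∀ ⦃ε : ℝ⦄, 0 < ε → ε < ε₁ →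
      ∃ r₁ : ℕ, ∀ r₀ ≥ r₁, ∃ n₁ : ℕ, ∃ δ > (0 : ℝ), ∃ C : ℝ,
        ∀ t : unitInterval, |(t : ℝ) - 1 / 2| < δ → (t : ℝ) ≠ 1 / 2 →
          ∀ N : ℕ, n₁ ≤ N → 4 * N ≤ charLength ε t →
            oneArmPivotalSum t N ≤
              C * ((N : ℝ) ^ 2 * fourArmProbAt t r₀ N) * (triSitePercolation t).real (triOneArm N) := by
  obtain ⟨εB, hεB, HB⟩ := oneArmPivotalSum_bulk_le_twoSided hQM hLB
  obtain ⟨εY, hεY, HY⟩ := oneArmPivotalSum_layer_le_twoSided hQM hLB hHPW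
  refine ⟨min εB εY, lt_min hεB hεY, fun ε hε hε₁ => ?_⟩
  obtain ⟨rB, HB⟩ := HB hε (hε₁.trans_le (min_le_left _ _))
  obtain ⟨rY, HY⟩ := HY hε (hε₁.trans_le (min_le_right _ _))
  refine ⟨max rB rY, fun r₀ hr₀ => ?_⟩
  obtain ⟨nB, δB, hδB, CB, HB⟩ := HB r₀ ((le_max_left _ _).trans hr₀)
  obtain ⟨nY, δY, hδY, CY, HY⟩ := HY r₀ ((le_max_right _ _).trans hr₀)
  refine ⟨max nB nY, min δB δY, lt_min hδB hδY, CB + CY, fun t htδ htne N hN hNL => ?_⟩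
  have hB := HB t (htδ.trans_le (min_le_left _ _)) htne N ((le_max_left _ _).trans hN) hNL
  have hY := HY t (htδ.trans_le (min_le_right _ _)) htne N ((le_max_right _ _).trans hN) hNL
  have hsplit : oneArmPivotalSum t N =
      ∑ v ∈ triBall (9 * N / 10), (triSitePercolation t).real {ω | IsPivotal (triOneArm N) v ω} +
        ∑ k ∈ Finset.Ico (9 * N / 10 + 1) (N + 1), ∑ v ∈ triSphere k,
          (triSitePercolation t).real {ω | IsPivotal (triOneArm N) v ω} := by
    rw [oneArmPivotalSum, sum_triBall_eq_sum_triSphere, sum_triBall_eq_sum_triSphere,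
      Finset.range_eq_Ico, Finset.range_eq_Ico]
    exact (Finset.sum_Ico_consecutive _ (by omega) (by omega)).symm
  rw [hsplit, add_mul, add_mul]
  exact add_le_add hB hY

/-! ### The easy-way potential: colour exchange and transposition -/

/-- **Colour exchange and transposition for pivotal sites of a parallelogram crossing**:
`P_{1-t}(v pivotal for LR(m, n)) = P_t(v' pivotal for LR(n, m))`, `v' = (v₁, v₀)`: `ω ↦ ωᶜ` maps
`P_t` to `P_{1-t}` and pivotality for the open left–right crossing to pivotality for the closed one,
i.e. (Hex lemma) for the open top–bottom crossing, the transpose of `LR(n, m)`. The tree's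
`real_isPivotal_triLRCrossing_symm` is the rhombus case `m = n`. [cite: Nolin2008, §7.3, proof of Prop. 34, first sentence (arXiv 0711.4948: Prop. 32)] [cite: BollobasRiordan2006, Ch. 5, Lemma 7] -/
theorem real_isPivotal_triLRCrossing_symm' (t : unitInterval) (m n : ℕ) (v : Site 2) :
    (triSitePercolation (σ t)).real {ω | IsPivotal (triLRCrossing m n) v ω} =
      (triSitePercolation t).real {ω | IsPivotal (triLRCrossing n m) (transposeIso v) ω} := by
  have hA : (compl ⁻¹' triLRCrossing m n : Set (SiteConfig (Site 2)))ᶜ = triTBCrossing m n := by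
    rw [← Set.preimage_compl, compl_triLRCrossing_eq, Set.preimage_preimage]
    conv_rhs => rw [← Set.preimage_id (s := triTBCrossing m n)]
    congr 1
    funext ω
    exact compl_compl ω
  calc (triSitePercolation (σ t)).real {ω | IsPivotal (triLRCrossing m n) v ω}
      = (triSitePercolation t).real (compl ⁻¹' {ω | IsPivotal (triLRCrossing m n) v ω}) := by
        rw [triSitePercolation, triSitePercolation, sitePercolation_real_preimage_compl]
    _ = (triSitePercolation t).real {ω | IsPivotal (triTBCrossing m n) v ω} := by
        rw [preimage_compl_setOf_isPivotal]
        congr 1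
        ext ω
        rw [Set.mem_setOf_eq, Set.mem_setOf_eq, ← isPivotal_compl_iff (compl ⁻¹' triLRCrossing m n), hA]
    _ = (triSitePercolation t).real
          (SiteConfig.relabel transposeIso.toEquiv ⁻¹'
            {ω' | IsPivotal (triLRCrossing n m) (transposeIso v) ω'}) := by
        rw [← relabel_transpose_preimage_triLRCrossing m n]
        exact congrArg _ (preimage_relabel_setOf_isPivotal transposeIso.toEquiv _ v).symm
    _ = (triSitePercolation t).real {ω | IsPivotal (triLRCrossing n m) (transposeIso v) ω} := by
        rw [triSitePercolation, sitePercolation_real_preimage_relabel]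

/-- The transposition maps `R(m, n)` to `R(n, m)`. [folklore] -/
theorem transposeIso_mem_rectangle {m n : ℕ} {v : Site 2} (hv : v ∈ rectangle m n) :
    transposeIso v ∈ rectangle n m := by
  rw [mem_rectangle_iff] at hv ⊢
  rw [transposeIso_apply_zero, transposeIso_apply_one]
  tauto

/-- **The pivotal count of the easy-way crossing is Werner's pivotal count at the dual parameter**:
`Σ_{v ∈ R(N, 2N)} P_t(v pivotal for LR(N, 2N)) = Σ_{x ∈ R(2N, N)} P_{1-t}(x pivotal for H(N))`
(`paraPivotalSum (1 - t) N`; `LR(N, 2N)`, of width `N` and height `2N`, is crossed "the easy way").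
Colour exchange and transposition, `real_isPivotal_triLRCrossing_symm'`. This is how Werner's
Lemma 6.2, stated for `p ≥ 1/2`, serves the sub-critical side. [cite: WernerPCMI2009, Lecture 6, Lemma 6.2 (with §2, "uniformly for all p ≥ 1/2")] [cite: Nolin2008, §7.3, proof of Prop. 34, first sentence (arXiv 0711.4948: Prop. 32)] -/
theorem sum_isPivotal_easy_eq_paraPivotalSum_symm (t : unitInterval) (N : ℕ) :
    ∑ v ∈ rectangle N (2 * N), (triSitePercolation t).real {ω | IsPivotal (triLRCrossing N (2 * N)) v ω} =
      paraPivotalSum (σ t) N := by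
  unfold paraPivotalSum
  simp_rw [real_isPivotal_triLRCrossing_symm' t (2 * N) N]
  symm
  exact Finset.sum_nbij' (fun v => transposeIso v) (fun v => transposeIso v)
    (fun v hv => transposeIso_mem_rectangle hv) (fun v hv => transposeIso_mem_rectangle hv)
    (fun v _ => transposeIso_transposeIso v) (fun v _ => transposeIso_transposeIso v) fun v _ => rfl

/-- **Russo's formula for the easy-way crossing** `P_q(LR(N, 2N))`: its derivative at `q ∈ (0, 1)` is
`Σ_{v ∈ R(N, 2N)} P_q(v pivotal) = paraPivotalSum (1 - q) N`. [cite: WernerPCMI2009, Lecture 6, proof of Lemma 6.2 (first display)] -/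
theorem hasDerivAt_triLRCrossingProb_easy (N : ℕ) {q : ℝ} (hq : q ∈ Ioo (0 : ℝ) 1) :
    HasDerivAt (fun r : ℝ => triLRCrossingProb (projIcc (0 : ℝ) 1 zero_le_one r) N (2 * N))
      (paraPivotalSum (σ (projIcc (0 : ℝ) 1 zero_le_one q)) N) q := by
  have h := site_russo_formula_sum (isUpperSet_triLRCrossing N (2 * N)) (rectangle N (2 * N))
    (KestenRelationRusso.determinedBy_triLRCrossing N (2 * N)) hq
  rwa [← sum_isPivotal_easy_eq_paraPivotalSum_symm]

/-- **Integration along the easy-way crossing probability, sub-critical side** (Werner 2009, Lecture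
6, §5, integration of the differential inequality, here from `p < 1/2` up to `1/2` against the
potential `t ↦ P_t(LR(N, 2N)) ∈ [0, 1]`, whose derivative is `paraPivotalSum (1 - t) N`): for an event
`E` determined by a finite set `F`, `0 < p < 1/2` and `0 ≤ K`, if
`Σ_{v ∈ F} P_t(v pivotal for E) ≤ K · paraPivotalSum (1 - t) N · P_t(E)` for `t ∈ (p, 1/2)`, then
`P_{1/2}(E) ≤ e^K P_p(E)` and `P_p(E) ≤ e^K P_{1/2}(E)`. [cite: WernerPCMI2009, Lecture 6, §5 (integration before Lemma 6.3)] [cite: Nolin2008, §6.2, proof of Thm. 27, Case 1 (arXiv 0711.4948: Thm. 26)] -/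
theorem real_le_exp_mul_of_easy_pivotal_bound {E : Set (SiteConfig (Site 2))}
    (F : Finset (Site 2)) (hE : DeterminedBy E ↑F) {p : unitInterval} (hp0 : 0 < (p : ℝ))
    (hp2 : (p : ℝ) < 1 / 2) (N : ℕ) {K : ℝ} (hK : 0 ≤ K)
    (hpiv : ∀ t : unitInterval, (p : ℝ) < t → (t : ℝ) < 1 / 2 →
      ∑ v ∈ F, (triSitePercolation t).real {ω | IsPivotal E v ω} ≤
        K * paraPivotalSum (σ t) N * (triSitePercolation t).real E) :
    (triSitePercolation half).real E ≤ Real.exp K * (triSitePercolation p).real E ∧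
      (triSitePercolation p).real E ≤ Real.exp K * (triSitePercolation half).real E := by
  set g : ℝ → ℝ := fun r => triLRCrossingProb (projIcc (0 : ℝ) 1 zero_le_one r) N (2 * N) with hg
  set γ : ℝ → ℝ := fun r => paraPivotalSum (σ (projIcc (0 : ℝ) 1 zero_le_one r)) N with hγ
  have hb1 : (1 / 2 : ℝ) < 1 := by norm_num
  have hval : ∀ q ∈ Icc (p : ℝ) (1 / 2), ((projIcc (0 : ℝ) 1 zero_le_one q : unitInterval) : ℝ) = q :=
    fun q hq => by
      rw [projIcc_of_mem zero_le_one ⟨(hp0.trans_le hq.1).le, (hq.2.trans_lt hb1).le⟩]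
  have hgd : ∀ q ∈ Icc (p : ℝ) (1 / 2), HasDerivAt g (γ q) q := fun q hq =>
    hasDerivAt_triLRCrossingProb_easy N ⟨hp0.trans_le hq.1, hq.2.trans_lt hb1⟩
  have hpiv' : ∀ q ∈ Ioo (p : ℝ) (1 / 2),
      ∑ v ∈ F, (sitePercolation (Site 2) (projIcc (0 : ℝ) 1 zero_le_one q)).real
          {ω | IsPivotal E v ω} ≤
        K * γ q * (sitePercolation (Site 2) (projIcc (0 : ℝ) 1 zero_le_one q)).real E := by
    intro q hq
    set t : unitInterval := projIcc (0 : ℝ) 1 zero_le_one q with ht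
    have htq : (t : ℝ) = q := hval q (Ioo_subset_Icc_self hq)
    exact hpiv t (by rw [htq]; exact hq.1) (by rw [htq]; exact hq.2)
  have hmain := real_le_exp_mul_of_pivotal_bound F hE hp0 hp2.le hb1 hgd hpiv'
  have hg01 : ∀ q, 0 ≤ g q ∧ g q ≤ 1 := fun q => ⟨measureReal_nonneg, measureReal_le_one⟩
  have hexp : Real.exp (K * (g (1 / 2) - g p)) ≤ Real.exp K := by
    rw [Real.exp_le_exp]
    nlinarith [(hg01 (1 / 2)).2, (hg01 p).1, hK]
  have hprojh : projIcc (0 : ℝ) 1 zero_le_one (1 / 2) = half :=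
    Subtype.ext (by rw [projIcc_of_mem zero_le_one ⟨by norm_num, by norm_num⟩]; rfl)
  have hprojp : projIcc (0 : ℝ) 1 zero_le_one (p : ℝ) = p := projIcc_val zero_le_one p
  have hEa : ∀ r : ℝ, (sitePercolation (Site 2) (projIcc (0 : ℝ) 1 zero_le_one r)).real E =
      (triSitePercolation (projIcc (0 : ℝ) 1 zero_le_one r)).real E := fun r => rfl
  rw [hEa, hEa, hprojh, hprojp] at hmain
  have hnn : ∀ s : unitInterval, 0 ≤ (triSitePercolation s).real E := fun s => measureReal_nonneg
  exact ⟨hmain.1.trans (mul_le_mul_of_nonneg_right hexp (hnn _)),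
    hmain.2.trans (mul_le_mul_of_nonneg_right hexp (hnn _))⟩

/-! ### The sub-critical half from Werner's pivotal count, and Nolin's Thm. 27 (`j = 1`) from five named facts -/

/-- **The sub-critical half of Nolin's Thm. 27 (`j = 1`) from the pivotal estimate against Werner's
potential at the dual parameter, at radii `≤ L_ε / C`** (the easy-way variant of
`oneArm_sub_of_pivotal_bound_div`): if for small `ε` there are `n₁`, `δ > 0`, `K` with
`Σ_{v ∈ Λ_N} P_t(v pivotal for 0 ↔ ∂Λ_N) ≤ K · paraPivotalSum (1 - t) N · P_t(0 ↔ ∂Λ_N)` for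
`t ∈ (1/2 - δ, 1/2)`, `n₁ ≤ N`, `C N ≤ L_ε(t)`, then `c π₁(N) ≤ P_p(0 ↔ ∂Λ_N)` for `p ∈ (1/2 - δ', 1/2)`,
`N ≤ L_ε(p)`: integrate at `N' = ⌊N/4^C⌋` along `P_t(LR(N', 2N'))`
(`real_le_exp_mul_of_easy_pivotal_bound`), extend from `N'` to `N` at the sub-critical `p`
(`real_triOneArm_extend_iter`), small radii by the open segment. [cite: Nolin2008, §6.2, proof of Thm. 27, step 1 and Case 1 (arXiv 0711.4948: Thm. 26)] [cite: WernerPCMI2009, Lecture 6, §5 ("Using differential inequalities for the one-arm event")] -/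
theorem oneArm_sub_of_para_pivotal_bound_div (C : ℕ)
    (h : ∃ ε₁ > (0 : ℝ), ∀ ⦃ε : ℝ⦄, 0 < ε → ε < ε₁ → ∃ n₁ : ℕ, ∃ δ > (0 : ℝ), ∃ K : ℝ,
      ∀ t : unitInterval, 1 / 2 - δ < (t : ℝ) → (t : ℝ) < 1 / 2 →
        ∀ N : ℕ, n₁ ≤ N → C * N ≤ charLength ε t →
          oneArmPivotalSum t N ≤
            K * paraPivotalSum (σ t) N * (triSitePercolation t).real (triOneArm N)) :
    ∃ ε₁ > (0 : ℝ), ∀ ⦃ε : ℝ⦄, 0 < ε → ε < ε₁ → ∃ δ > (0 : ℝ), ∃ c > (0 : ℝ),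
      ∀ p : unitInterval, 1 / 2 - δ < (p : ℝ) → (p : ℝ) < 1 / 2 → ∀ N ≤ charLength ε p,
        c * critOneArmProb N ≤ (triSitePercolation p).real (triOneArm N) := by
  obtain ⟨ε₁, hε₁, h⟩ := h
  refine ⟨min ε₁ (1 / 2), lt_min hε₁ (by norm_num), fun ε hε hεlt => ?_⟩
  have hε₁' : ε < ε₁ := hεlt.trans_le (min_le_left _ _)
  have hε2 : ε < 1 / 2 := hεlt.trans_le (min_le_right _ _)
  obtain ⟨n₁, δ, hδ, K, hb⟩ := h hε hε₁'
  obtain ⟨cE, hcE, hE⟩ := real_triOneArm_extend_iter hε hε2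
  set j : ℕ := C with hj
  have hCj : C ≤ 4 ^ j := le_four_pow_self C
  have h4j : 1 ≤ 4 ^ j := Nat.one_le_pow _ _ (by norm_num)
  set n₂ : ℕ := max n₁ 8000 * 4 ^ j with hn₂
  set K' : ℝ := max K 0 with hK'
  have hK'0 : 0 ≤ K' := le_max_right _ _
  refine ⟨min δ (1 / 4), lt_min hδ (by norm_num),
    min (Real.exp (-K') * cE ^ j) ((1 / 4 : ℝ) ^ n₂), lt_min (by positivity) (by positivity),
    fun p hp1 hp2 N hN => ?_⟩
  have hπ0 : 0 ≤ critOneArmProb N := measureReal_nonneg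
  have hπ1 : critOneArmProb N ≤ 1 := measureReal_le_one
  have hp14 : (1 / 4 : ℝ) ≤ p := by
    have := min_le_right δ (1 / 4); linarith
  have hpδ : 1 / 2 - δ < (p : ℝ) := by
    have := min_le_left δ (1 / 4); linarith
  rcases lt_or_ge N n₂ with hNlt | hNge
  · -- small radii: the open segment
    calc min (Real.exp (-K') * cE ^ j) ((1 / 4 : ℝ) ^ n₂) * critOneArmProb N ≤ (1 / 4 : ℝ) ^ n₂ * 1 :=
          mul_le_mul (min_le_right _ _) hπ1 hπ0 (by positivity)
      _ ≤ (1 / 4 : ℝ) ^ (N + 1) := by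
          rw [mul_one]; exact pow_le_pow_of_le_one (by norm_num) (by norm_num) (by omega)
      _ ≤ (p : ℝ) ^ (N + 1) := pow_le_pow_left₀ (by norm_num) hp14 _
      _ ≤ _ := pow_succ_le_real_triOneArm p N
  · -- large radii: integration at `N' = N / 4^C`, then extension from `N'` to `N`
    set N' : ℕ := N / 4 ^ j with hN'
    have hN'ge : max n₁ 8000 ≤ N' := (Nat.le_div_iff_mul_le (by positivity)).2 hNge
    have hN'n₁ : n₁ ≤ N' := le_trans (le_max_left _ _) hN'ge
    have hN'1 : 1 ≤ N' := le_trans (by omega) (le_trans (le_max_right _ _) hN'ge)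
    have hCN' : C * N' ≤ N :=
      calc C * N' ≤ 4 ^ j * N' := Nat.mul_le_mul_right _ hCj
        _ ≤ N := Nat.mul_div_le N (4 ^ j)
    have hN'N : N' ≤ N := Nat.div_le_self _ _
    have hp0 : 0 < (p : ℝ) := by linarith
    have hpiv : ∀ t : unitInterval, (p : ℝ) < t → (t : ℝ) < 1 / 2 →
        ∑ v ∈ triBall N', (triSitePercolation t).real {ω | IsPivotal (triOneArm N') v ω} ≤
          K' * paraPivotalSum (σ t) N' * (triSitePercolation t).real (triOneArm N') := by
      intro t ht1 ht2
      have hpt : p ≤ t := Subtype.coe_le_coe.1 ht1.le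
      have hNt : C * N' ≤ charLength ε t :=
        hCN'.trans (hN.trans (charLength_le_charLength_of_lt_half hε hpt ht2))
      have h1 := hb t (by linarith) ht2 N' hN'n₁ hNt
      have hnn : 0 ≤ paraPivotalSum (σ t) N' * (triSitePercolation t).real (triOneArm N') :=
        mul_nonneg (paraPivotalSum_nonneg _ N') measureReal_nonneg
      calc ∑ v ∈ triBall N', (triSitePercolation t).real {ω | IsPivotal (triOneArm N') v ω}
          = oneArmPivotalSum t N' := rfl
        _ ≤ K * paraPivotalSum (σ t) N' * (triSitePercolation t).real (triOneArm N') := h1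
        _ = K * (paraPivotalSum (σ t) N' * (triSitePercolation t).real (triOneArm N')) :=
            mul_assoc _ _ _
        _ ≤ K' * (paraPivotalSum (σ t) N' * (triSitePercolation t).real (triOneArm N')) :=
            mul_le_mul_of_nonneg_right (le_max_left _ _) hnn
        _ = K' * paraPivotalSum (σ t) N' * (triSitePercolation t).real (triOneArm N') :=
            (mul_assoc _ _ _).symm
    have hG := (real_le_exp_mul_of_easy_pivotal_bound (triBall N') (determinedBy_triOneArm N')
      hp0 hp2 N' hK'0 hpiv).1
    -- extension at the sub-critical `p`: `cE^j P_p(0 ↔ ∂Λ_{N'}) ≤ P_p(0 ↔ ∂Λ_N)`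
    have hext := hE p j N (le_trans (Nat.mul_le_mul_right _ (le_max_right _ _)) hNge) fun _ => hN
    have hπ : critOneArmProb N ≤ critOneArmProb N' :=
      measureReal_mono (triOneArm_anti hN'1 hN'N) (measure_ne_top _ _)
    calc min (Real.exp (-K') * cE ^ j) ((1 / 4 : ℝ) ^ n₂) * critOneArmProb N
        ≤ Real.exp (-K') * cE ^ j * critOneArmProb N' :=
          mul_le_mul (min_le_left _ _) hπ hπ0 (by positivity)
      _ ≤ Real.exp (-K') * cE ^ j * (Real.exp K' * (triSitePercolation p).real (triOneArm N')) :=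
          mul_le_mul_of_nonneg_left hG (by positivity)
      _ = cE ^ j * (triSitePercolation p).real (triOneArm N') := by
          have : Real.exp (-K') * Real.exp K' = 1 := by rw [← Real.exp_add, neg_add_cancel, Real.exp_zero]
          calc Real.exp (-K') * cE ^ j * (Real.exp K' * (triSitePercolation p).real (triOneArm N'))
              = (Real.exp (-K') * Real.exp K') * (cE ^ j * (triSitePercolation p).real (triOneArm N')) := by
                ring
            _ = _ := by rw [this, one_mul]
      _ ≤ (triSitePercolation p).real (triOneArm N) := hext

/-- **The sub-critical pivotal estimate from Werner's Lemma 6.2 at the dual parameter** (Werner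
2009, Lecture 6, §5 with Lemma 6.2; Nolin 2008, §6.2, proof of Thm. 27, Case 1, "uniformly in `P̂`
between `P_p` and `P_{1-p}`"): from (C) two-sidedly (`oneArmPivotalSum_le_twoSided`:
`Σ_v P_t(v pivotal) ≤ C N² π̂_t(r₀, N) P_t(0 ↔ ∂Λ_N)`), the symmetry `π̂_t = π̂_{1-t}`
(`fourArmProbAt_symm`) and the lower half of Lemma 6.2 at `1 - t ∈ (1/2, 1/2 + δ)`
(`Werner2009_lemma62P`: `c N² π̂_{1-t}(r₀, N) ≤ paraPivotalSum (1 - t) N`, `N ≤ L(1 - t, ε) = L(t, ε)`):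
for small `ε` there are `n₁`, `δ > 0`, `K` with
`Σ_{v ∈ Λ_N} P_t(v pivotal for 0 ↔ ∂Λ_N) ≤ K · paraPivotalSum (1 - t) N · P_t(0 ↔ ∂Λ_N)` for
`t ∈ (1/2 - δ, 1/2)`, `n₁ ≤ N`, `4N ≤ L_ε(t)`. [cite: WernerPCMI2009, Lecture 6, §5 with Lemma 6.2] [cite: Nolin2008, §6.2, proof of Thm. 27, Case 1 (arXiv 0711.4948: Thm. 26)] -/
theorem oneArm_para_pivotal_bound_of_facts (hQM : Werner2009_fourArm_quasiMult)
    (hLB : Werner2009_fourArm_lowerBound) (hHPW : Werner2009_halfPlane_twoArm)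
    (hA : Werner2009_lemma62P) :
    ∃ ε₁ > (0 : ℝ), ∀ ⦃ε : ℝ⦄, 0 < ε → ε < ε₁ → ∃ n₁ : ℕ, ∃ δ > (0 : ℝ), ∃ K : ℝ,
      ∀ t : unitInterval, 1 / 2 - δ < (t : ℝ) → (t : ℝ) < 1 / 2 →
        ∀ N : ℕ, n₁ ≤ N → 4 * N ≤ charLength ε t →
          oneArmPivotalSum t N ≤
            K * paraPivotalSum (σ t) N * (triSitePercolation t).real (triOneArm N) := by
  obtain ⟨εC, hεC, HC⟩ := oneArmPivotalSum_le_twoSided hQM hLB hHPW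
  obtain ⟨εA, hεA, HA⟩ := hA
  refine ⟨min εC εA, lt_min hεC hεA, fun ε hε hε₁ => ?_⟩
  have hεC' : ε < εC := hε₁.trans_le (min_le_left _ _)
  have hεA' : ε < εA := hε₁.trans_le (min_le_right _ _)
  obtain ⟨rC, HC⟩ := HC hε hεC'
  obtain ⟨rA, HA⟩ := HA hε hεA'
  set r₀ : ℕ := max rC rA with hr₀
  obtain ⟨nC, δC, hδC, C, hC⟩ := HC r₀ (le_max_left _ _)
  obtain ⟨nA, δA, hδA, c, hc, CA, hAb⟩ := HA r₀ (le_max_right _ _)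
  set C' : ℝ := max C 0 with hC'
  refine ⟨max nC nA, min δC δA, lt_min hδC hδA, C' / c, fun t ht1 ht2 N hN hNL => ?_⟩
  have htC : |(t : ℝ) - 1 / 2| < δC := by
    rw [abs_sub_lt_iff]; constructor <;> linarith [min_le_left δC δA]
  have htne : (t : ℝ) ≠ 1 / 2 := ht2.ne
  have hNC : nC ≤ N := (le_max_left _ _).trans hN
  have hNA : nA ≤ N := (le_max_right _ _).trans hN
  have hNLε : N ≤ charLength ε t := le_trans (by omega) hNL
  have hNW : N ≤ charLengthW ε t := hNLε.trans (charLength_le_charLengthW hε htne)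
  -- (C) at `t`
  have hsum := hC t htC htne N hNC hNL
  -- Lemma 6.2 at `1 - t`
  obtain ⟨hs1, hs2⟩ := symm_mem_of_lt_half (δ := δA) ht2 (by linarith [min_le_right δC δA])
  have hlow := (hAb (σ t) hs1.le hs2 N hNA fun _ => by rw [charLengthW_symm]; exact hNW).1
  rw [fourArmProbAt_symm] at hlow
  -- `Σ ≤ C' N² π̂_t P ≤ (C'/c) · para(1-t) · P`
  have hA0 : 0 ≤ (triSitePercolation t).real (triOneArm N) := measureReal_nonneg
  have hN2π : 0 ≤ (N : ℝ) ^ 2 * fourArmProbAt t r₀ N := by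
    have := fourArmProbAt_nonneg t r₀ N; positivity
  have hC'0 : 0 ≤ C' := le_max_right _ _
  calc oneArmPivotalSum t N
      ≤ C * ((N : ℝ) ^ 2 * fourArmProbAt t r₀ N) * (triSitePercolation t).real (triOneArm N) := hsum
    _ ≤ C' * ((N : ℝ) ^ 2 * fourArmProbAt t r₀ N) * (triSitePercolation t).real (triOneArm N) :=
        mul_le_mul_of_nonneg_right (mul_le_mul_of_nonneg_right (le_max_left _ _) hN2π) hA0
    _ ≤ C' / c * paraPivotalSum (σ t) N * (triSitePercolation t).real (triOneArm N) := by
        apply mul_le_mul_of_nonneg_right _ hA0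
        rw [div_mul_eq_mul_div, le_div_iff₀ hc]
        calc C' * ((N : ℝ) ^ 2 * fourArmProbAt t r₀ N) * c
            = C' * (c * ((N : ℝ) ^ 2 * fourArmProbAt t r₀ N)) := by ring
          _ ≤ C' * paraPivotalSum (σ t) N := mul_le_mul_of_nonneg_left hlow hC'0

/-- **Nolin's Thm. 27 for one arm from the five named facts behind Werner's one-arm stability**
(Nolin 2008, §6.1, Thm. 27 [arXiv 0711.4948: Thm. 26], `j = 1`: `c π₁(N) ≤ P_p(0 ↔ ∂Λ_N) ≤ C π₁(N)`
for `p ≠ 1/2` near `1/2`, `N ≤ L_ε(p)`, every `ε ∈ (0, 1/2)`): `Werner2009_fourArm_quasiMult`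
(Werner Cor. 6.2), `Werner2009_fourArm_lowerBound` (§3), `Nolin2008_halfPlane_twoArm` (Nolin
Thm. 24 (i)), `Werner2009_halfPlane_twoArm` (§3 ¶1) and `Werner2009_pivotal_lowerBound` (proof of
Lemma 6.2) — exactly the facts from which the tree proves `Werner2009_oneArm_nearCritical`
(`Werner2009_oneArm_nearCritical_of_facts`), which is the super-critical half; the sub-critical half
is the integration (`oneArm_sub_of_para_pivotal_bound_div`, `C = 4`) of
`oneArm_para_pivotal_bound_of_facts`, with (A) `Werner2009_lemma62P_of_facts`. Everything else —
RSW below `L_ε` on both sides, circuits, quasi-multiplicativity and extendability of one arm, the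
geometry of pivotal sites (cut points, painted exterior, mixed half-plane pair), the colour-exchange
symmetries, Russo's formula and inequality, the Grönwall step, the summations — is proved in the
tree. [cite: Nolin2008, §6.1–6.2, Thm. 27 and its proof (arXiv 0711.4948: Thm. 26), case j = 1] [cite: WernerPCMI2009, Lecture 6, §3–§5 (Cor. 6.2, Lemma 6.2, "Using differential inequalities for the one-arm event")] -/
theorem Nolin2008_thm27_oneArm_of_facts (hQM : Werner2009_fourArm_quasiMult)
    (hLB : Werner2009_fourArm_lowerBound) (hHP : Nolin2008_halfPlane_twoArm)
    (hHPW : Werner2009_halfPlane_twoArm) (hP : Werner2009_pivotal_lowerBound) :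
    Nolin2008_thm27_oneArm :=
  Nolin2008_thm27_oneArm_of_nearCritical_of_sub
    (Werner2009_oneArm_nearCritical_of_facts hQM hLB hHP hHPW hP)
    (oneArm_sub_of_para_pivotal_bound_div 4
      (oneArm_para_pivotal_bound_of_facts hQM hLB hHPW (Werner2009_lemma62P_of_facts hQM hLB hHPW hP)))

/-- **Nolin's Thm. 27 for one arm from Werner's one-arm stability (C)-(A) facts**: the same with the
super-critical half taken from the named fact `Werner2009_oneArm_nearCritical` itself and (A) from
`Werner2009_lemma62P`, so that only the three facts entering the sub-critical pivotal sum are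
needed besides. [cite: Nolin2008, §6.1, Thm. 27 (arXiv 0711.4948: Thm. 26), case j = 1] -/
theorem Nolin2008_thm27_oneArm_of_nearCritical_of_facts (h1 : Werner2009_oneArm_nearCritical)
    (hA : Werner2009_lemma62P) (hQM : Werner2009_fourArm_quasiMult)
    (hLB : Werner2009_fourArm_lowerBound) (hHPW : Werner2009_halfPlane_twoArm) :
    Nolin2008_thm27_oneArm :=
  Nolin2008_thm27_oneArm_of_nearCritical_of_sub h1
    (oneArm_sub_of_para_pivotal_bound_div 4 (oneArm_para_pivotal_bound_of_facts hQM hLB hHPW hA))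

end Literature.Probability.Percolation
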